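import Summits.NavierStokesRegularity.NavierStokesRegularity.Theorems.SwirlFreeBudget
import Literature.Analysis.PDE.GiaquintaIterationLemma
import HarnessLib

/-!
# ROUND-19 (nsreg-p2, gen 21) — `LogModulusBudget`, §§3–5: the FBC dictionary, the start
# dissolver (Giaquinta's iteration lemma, PROVED) and the appendix constants

Third part of planner nsreg-p2's ROUND-19 companion `R19-LogModulusBudget.lean` (v3, sha16
76d26907de711d48; §1 and the full module docstring with sources are in
`…Theorems.LogModulusBudget`, §2 in `…Theorems.LogModulusBudgetEngine`; split for the 400-line
rule by the landing seat nsreg-p4 g12, body verbatim).  Contents: §3 the FBC dictionary — from the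
log²-modulus constant `G` to Lei–Zhang's constants `C_* = 16G` (`fbcOneConst`), `δ_* = 16G²/ln²(2δ)`
(`fbcTwoConst`), the closure product `δ_* C_*²` (`closureProduct`) and the localisation scale
`δ(G) = ½ exp(-G²/√κ)` (`fbcScale`) at which the closure product is the absolute number `4096κ`
(`closureProduct_fbcScale`, PROVED; `inv_fbcScale`: `δ⁻¹ = 2 exp(G²/√κ)` — the only exponential);
§4 the start dissolver — the discrete absorption lemma and Giaquinta's iteration lemma
(Giaquinta 1983, Ch. V Lemma 3.1) are the TREE theorems
`Literature.Analysis.PDE.Giaquinta1983.{absorb_iterate, exists_ratio, giaquinta_iteration, lemma_V_3_1}`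
(not restated); §5 the appendix constants of
`R19-APPENDIX-TermTable.md` §B (`closure_weights`, `closureKappa = 1/(3072·4096)`,
`3547 ≤ 1/√κ₀ ≤ 3548`, PROVED).
Memo: `run/shared/lean/pub/ns-regularity-ideate/ns-regularity-ideate-p2/ROUND-19.md`.
WHAT THIS IS NOT: not NS regularity — elementary real analysis (constants bookkeeping and an
iteration lemma) serving typed LINE material for the DORMANT route `SwirlThreshold`
(crux stmt-NavierStokesRegularity-2002); no crux claim.
-/

noncomputable section

namespace Summit.NavierStokesRegularity.NavierStokesRegularity.Theorems.LogModulusBudget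

open MeasureTheory Set Filter Topology Metric
open scoped ENNReal NNReal Topology
open Literature.Analysis Literature.Analysis.FluidPDE
open Summit.NavierStokesRegularity.NavierStokesRegularity.Theorems.SwirlFreeBudget

/-! ## 3. The FBC dictionary: from the modulus constant `G` to the localisation scale `δ(G)` -/

/-- Lei–Zhang's SCALE-FREE FBC-1 constant for modulus constant `G`: the tree's
`integral_abs_angVelQuot_mul_norm_sq_le` has `∫|u^θ/r|‖F‖² ≤ 16C₁∫‖DF[e_r]‖² + …` under
`|Γ| ≤ C₁/ln²r` (log-Hardy constant `4`); no choice of scale makes it small. -/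
def fbcOneConst (G : ℝ) : ℝ :=
  16 * G

/-- Lei–Zhang's FBC-2 constant at localisation scale `δ`: the tree's
`integral_swirl_sq_mul_norm_sq_le` has `∫(u^θ)²‖F‖² ≤ (16C₁²/ln²(2δ))∫‖DF[e_r]‖² + …` under
`|Γ| ≤ C₁/ln²r` on `r ≤ 2δ`; it tends to `0` as `δ → 0`. -/
def fbcTwoConst (G δ : ℝ) : ℝ :=
  16 * G ^ 2 / (Real.log (2 * δ)) ^ 2

/-- **Lei–Zhang's closure product** `δ_* · C_*²`: in the `3C_*²`-weighted sum of the `J`- and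
`Ω`-energy inequalities (LZ17 p. 8, (E5)+3C_*²(E6)) the term to absorb is `3C_*²K₀δ_*‖∇Ω‖²`
against `‖∇Ω‖²`, so what must be small is `K₀ δ_* C_*²`, not `δ_*` alone. -/
def closureProduct (G δ : ℝ) : ℝ :=
  fbcTwoConst G δ * fbcOneConst G ^ 2

/-- **The localisation scale `δ(G) = ½·exp(-G²/√κ)`.** -/
def fbcScale (G κ : ℝ) : ℝ :=
  Real.exp (-(G ^ 2 / Real.sqrt κ)) / 2

/-- The localisation scale `δ(G) = ½ exp(-G²/√κ)` is positive. -/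
theorem fbcScale_pos (G κ : ℝ) : 0 < fbcScale G κ := by
  unfold fbcScale; positivity

/-- `2δ(G) = exp(-G²/√κ)`. -/
theorem two_mul_fbcScale (G κ : ℝ) : 2 * fbcScale G κ = Real.exp (-(G ^ 2 / Real.sqrt κ)) := by
  unfold fbcScale; ring

/-- `2δ(G) < 1` for `G, κ > 0`. -/
theorem two_mul_fbcScale_lt_one {G κ : ℝ} (hG : 0 < G) (hκ : 0 < κ) : 2 * fbcScale G κ < 1 := by
  rw [two_mul_fbcScale]
  have : 0 < G ^ 2 / Real.sqrt κ := by positivity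
  calc Real.exp (-(G ^ 2 / Real.sqrt κ)) < Real.exp 0 := Real.exp_lt_exp.2 (by linarith)
    _ = 1 := Real.exp_zero

/-- **PROVED: at `δ = δ(G)` the FBC-2 constant is `16κ/G²`** — it COMPENSATES the square of the
scale-free FBC-1 constant. -/
theorem fbcTwoConst_fbcScale {G κ : ℝ} (hG : 0 < G) (hκ : 0 < κ) :
    fbcTwoConst G (fbcScale G κ) = 16 * κ / G ^ 2 := by
  unfold fbcTwoConst
  rw [two_mul_fbcScale, Real.log_exp, neg_sq, div_pow, Real.sq_sqrt hκ.le]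
  have hG2 : G ^ 2 ≠ 0 := by positivity
  field_simp

/-- **PROVED: the closure product at `δ = δ(G)` is the ABSOLUTE number `4096κ`** (`G`-free): choosing
`κ = (2·3·4096·K₀)⁻¹` closes Lei–Zhang's weighted energy inequality for EVERY modulus constant `G`,
at the price of the scale `δ(G)`. -/
theorem closureProduct_fbcScale {G κ : ℝ} (hG : 0 < G) (hκ : 0 < κ) :
    closureProduct G (fbcScale G κ) = 4096 * κ := by
  unfold closureProduct fbcOneConst
  rw [fbcTwoConst_fbcScale hG hκ]
  have hG2 : G ^ 2 ≠ 0 := by positivity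
  field_simp
  ring

/-- **Where the exponential of the tower is born:** `δ(G)⁻¹ = 2·exp(G²/√κ)`; every factor `δ⁻ᵏ`
of the localised energy method (cut-off gradients, far-field terms, the covering of `Q(z₀,1/16)`
by cylinders of size `δ`, the polynomial endgame) is `exp(O(G²))`. -/
theorem inv_fbcScale (G κ : ℝ) :
    (fbcScale G κ)⁻¹ = 2 * Real.exp (G ^ 2 / Real.sqrt κ) := by
  unfold fbcScale
  rw [inv_div, Real.exp_neg, div_inv_eq_mul, mul_comm]

/-- Monotonicity: for `0 < δ ≤ δ(G)` the FBC-2 constant is `≤ 16κ/G²` (so the closure product is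
`≤ 4096κ` at every smaller scale too). -/
theorem fbcTwoConst_le_of_le {G κ δ : ℝ} (hG : 0 < G) (hκ : 0 < κ) (hδ : 0 < δ)
    (hle : δ ≤ fbcScale G κ) : fbcTwoConst G δ ≤ 16 * κ / G ^ 2 := by
  have h2δ1 : 2 * δ < 1 := by
    have := two_mul_fbcScale_lt_one hG hκ; linarith
  have hlog : Real.log (2 * δ) ≤ -(G ^ 2 / Real.sqrt κ) := by
    rw [← Real.log_exp (-(G ^ 2 / Real.sqrt κ)), ← two_mul_fbcScale]
    exact Real.log_le_log (by positivity) (by linarith)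
  have hpos : 0 < G ^ 2 / Real.sqrt κ := by positivity
  have hsq : (G ^ 2 / Real.sqrt κ) ^ 2 ≤ (Real.log (2 * δ)) ^ 2 := by
    have : G ^ 2 / Real.sqrt κ ≤ -Real.log (2 * δ) := by linarith
    calc (G ^ 2 / Real.sqrt κ) ^ 2 ≤ (-Real.log (2 * δ)) ^ 2 := by
          gcongr
      _ = (Real.log (2 * δ)) ^ 2 := by ring
  have hval : (G ^ 2 / Real.sqrt κ) ^ 2 = G ^ 4 / κ := by
    rw [div_pow, Real.sq_sqrt hκ.le]; ring
  unfold fbcTwoConst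
  rw [div_le_div_iff₀ (lt_of_lt_of_le (by positivity) hsq) (by positivity)]
  calc 16 * G ^ 2 * G ^ 2 = 16 * κ * (G ^ 4 / κ) := by field_simp
    _ ≤ 16 * κ * (Real.log (2 * δ)) ^ 2 := by rw [← hval]; gcongr

/-! ## 4. The start dissolver: hole-filling / Giaquinta's iteration lemma

The companion's §4 (`absorb_iterate`, `exists_ratio`, `giaquinta_iteration`) is IN THE TREE under
its printed citation: `Literature.Analysis.PDE.Giaquinta1983.absorb_iterate`, `.exists_ratio`,
`.giaquinta_iteration`, `.lemma_V_3_1` (`Literature/Analysis/PDE/GiaquintaIterationLemma.lean`,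
Giaquinta 1983, Ch. V Lemma 3.1) — imported above and not restated here (gate rule `dedup.landed`). -/

/-! ## 5. Appendix constants (R19-APPENDIX-TermTable.md §B): the closure weights and `κ` -/

/-- **The closure of the weighted Lei–Zhang system (Appendix B, (B.2)–(B.3)).**  If
`L_J ≤ (8/3)X + 96δ_* L_Ω + (16/3)Z` and `L_Ω ≤ 4Y + 16C_*² L_J + 4W` with `L_Ω ≥ 0` and the
CLOSURE PRODUCT `C_*²δ_* ≤ 1/3072`, then
`L_Ω ≤ 2(4Y + 4W + (128/3)C_*²X + (256/3)C_*²Z)` — every weight is a polynomial in `C_* = 16G`. -/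
theorem closure_weights {LJ LΩ X Z Y W Cs ds : ℝ} (hLΩ : 0 ≤ LΩ)
    (hJ : LJ ≤ 8 / 3 * X + 96 * ds * LΩ + 16 / 3 * Z)
    (hΩ : LΩ ≤ 4 * Y + 16 * Cs ^ 2 * LJ + 4 * W) (hP : Cs ^ 2 * ds ≤ 1 / 3072) :
    LΩ ≤ 2 * (4 * Y + 4 * W + 128 / 3 * Cs ^ 2 * X + 256 / 3 * Cs ^ 2 * Z) := by
  have hCs : 0 ≤ Cs ^ 2 := sq_nonneg _
  have h1 : 16 * Cs ^ 2 * LJ ≤ 16 * Cs ^ 2 * (8 / 3 * X + 96 * ds * LΩ + 16 / 3 * Z) :=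
    mul_le_mul_of_nonneg_left hJ (by positivity)
  have h2 : 16 * Cs ^ 2 * (96 * ds * LΩ) = 1536 * (Cs ^ 2 * ds) * LΩ := by ring
  have h3 : 1536 * (Cs ^ 2 * ds) * LΩ ≤ 1 / 2 * LΩ := by nlinarith
  nlinarith

/-- The companion bound for `L_J` (substitute back into (B.2)). -/
theorem closure_weights_J {LJ LΩ X Z Y W Cs ds : ℝ} (hLΩ : 0 ≤ LΩ) (hds : 0 ≤ ds)
    (hJ : LJ ≤ 8 / 3 * X + 96 * ds * LΩ + 16 / 3 * Z)
    (hΩ : LΩ ≤ 4 * Y + 16 * Cs ^ 2 * LJ + 4 * W) (hP : Cs ^ 2 * ds ≤ 1 / 3072) :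
    LJ ≤ 8 / 3 * X + 16 / 3 * Z +
      96 * ds * (2 * (4 * Y + 4 * W + 128 / 3 * Cs ^ 2 * X + 256 / 3 * Cs ^ 2 * Z)) := by
  have h := closure_weights hLΩ hJ hΩ hP
  have h1 : 96 * ds * LΩ ≤
      96 * ds * (2 * (4 * Y + 4 * W + 128 / 3 * Cs ^ 2 * X + 256 / 3 * Cs ^ 2 * Z)) :=
    mul_le_mul_of_nonneg_left h (by positivity)
  linarith

/-- **The absolute `κ` of the appendix:** `κ₀ = 1/(3072·4096)`, so that the closure product at the
scale `δ(G) = fbcScale G κ₀` is exactly `1/3072` (`closureProduct_fbcScale`). -/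
def closureKappa : ℝ := 1 / (3072 * 4096)

/-- `κ₀ > 0`. -/
theorem closureKappa_pos : 0 < closureKappa := by unfold closureKappa; positivity

/-- At `κ = κ₀ = 1/(3072·4096)` the closure product at the scale `δ(G)` equals `4096κ₀ = 1/3072`. -/
theorem closureProduct_fbcScale_closureKappa {G : ℝ} (hG : 0 < G) :
    closureProduct G (fbcScale G closureKappa) = 1 / 3072 := by
  rw [closureProduct_fbcScale hG closureKappa_pos]; unfold closureKappa; norm_num

/-- `1/√κ₀ = √12582912 ∈ [3547, 3548]`: the appendix's `δ(G) = ½·exp(−3547.2…·G²)`. [this work] -/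
theorem inv_sqrt_closureKappa_bounds :
    3547 ≤ 1 / Real.sqrt closureKappa ∧ 1 / Real.sqrt closureKappa ≤ 3548 := by
  have hκ : closureKappa = 1 / 12582912 := by unfold closureKappa; norm_num
  have hs : Real.sqrt closureKappa = 1 / Real.sqrt 12582912 := by
    rw [hκ, Real.sqrt_div' (1 : ℝ) (by norm_num : (0 : ℝ) ≤ 12582912), Real.sqrt_one]
  have hpos : 0 < Real.sqrt 12582912 := Real.sqrt_pos.mpr (by norm_num)
  rw [hs, one_div_one_div]
  constructor
  · rw [show (3547 : ℝ) = Real.sqrt (3547 ^ 2) by rw [Real.sqrt_sq]; norm_num]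
    exact Real.sqrt_le_sqrt (by norm_num)
  · rw [show (3548 : ℝ) = Real.sqrt (3548 ^ 2) by rw [Real.sqrt_sq]; norm_num]
    exact Real.sqrt_le_sqrt (by norm_num)

/-- Hence the localisation scale of the appendix: `δ(G)⁻¹ ≤ 2·exp(3548·G²)` and
`δ(G)⁻¹ ≥ 2·exp(3547·G²)` — ONE exponential of a quadratic in `G`. -/
theorem inv_fbcScale_closureKappa_le (G : ℝ) :
    (fbcScale G closureKappa)⁻¹ ≤ 2 * Real.exp (3548 * G ^ 2) := by
  rw [inv_fbcScale]
  have h := inv_sqrt_closureKappa_bounds.2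
  have hG : 0 ≤ G ^ 2 := sq_nonneg G
  have : G ^ 2 / Real.sqrt closureKappa ≤ 3548 * G ^ 2 := by
    rw [div_eq_mul_one_div]; nlinarith
  gcongr

end Summit.NavierStokesRegularity.NavierStokesRegularity.Theorems.LogModulusBudget

end
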